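import Summits.Ventures.PackingBounds.Configurations.GramIsometry
import Summits.Ventures.PackingBounds.Energy.CrossPolytopeUniversal
import Literature.Geometry.DiscreteGeometry.DelsarteLinearProgrammingBound

/-!
# Uniqueness of the cross-polytope: `2n` points on `S^{n-1}` at angular distance `≥ π/2`

Framing: lottery ticket; floor = certified bounds/negative ranges. Venture `PackingBounds` (cell
`pub-packcert`, seat `pub-packcert-energy`) — Cohn–Kumar Table 1, the cross-polytope rows (all `n ≥ 3`),
uniqueness column.

The Delsarte certificate `F(t) = 2μ(μ+1) t(t+1) = μ C_0 + (μ+1) C_1^{(μ)} + C_2^{(μ)}` (`n = 2μ + 2 ≥ 3`) proves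
`A(n, π/2) ≤ 2n` (`card_le_two_mul`) and is sharp: by complementary slackness
(`DelsarteLP.sum_eq_zero_of_card_mul_eq`) a `2n`-point code with pairwise inner products `≤ 0` has all
inner products in `{0, -1}` (`inner_eq_zero_or_of_card_eq`). A maximal antipodal-free part is then an
orthonormal `n`-frame `R` with `C = R ⊔ (-R)` (`exists_frame`), so the ordered Gram data of `C` is that of the
regular cross-polytope and any two such codes are isometric (`isometric_of_crossPolytope_codes`, via
`GramIsometry.exists_linearIsometryEquiv_of_inner_eq`). With the cell's universal bound
(`Energy.crossPolytope_energy_ge` / `UniversalCrossPolytope…`) this is the uniqueness of the cross-polytope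
as optimal `2n`-point code of `ℝⁿ`.

## References
* H. Cohn, A. Kumar, J. Amer. Math. Soc. 20 (2007) 99–148, Table 1. [`CohnKumar2006`]
* R. A. Rankin, *The closest packing of spherical caps in n dimensions*, Proc. Glasgow Math. Assoc. 2 (1955) 139–144.
-/

noncomputable section

namespace Summit.Ventures.PackingBounds.Config.CrossPolytopeUnique

open Finset Module Literature.Analysis.SpecialFunctions Literature.Geometry.DiscreteGeometry
  Summit.Ventures.PackingBounds.Energy

variable {n : ℕ}

/-- The Delsarte certificate for angle `π/2`: coefficients `(μ, μ+1, 1)` of `2μ(μ+1) t(1+t)`. -/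
private theorem cert_eval (μ t : ℝ) :
    ∑ k ∈ range (2 + 1), (fun k : ℕ => if k = 0 then μ else if k = 1 then μ + 1 else (1 : ℝ)) k *
      gegenbauerSum μ k t = 2 * μ * (μ + 1) * (t * (1 + t)) := by
  simp only [Finset.sum_range_succ, Finset.sum_range_zero, gegenbauerSum_zero, gegenbauerSum_one,
    gegenbauerSum_two]
  norm_num
  ring

/-- **Rankin / Delsarte: `A(n, π/2) ≤ 2n`** — at most `2n` unit vectors of `ℝⁿ` (`n ≥ 3`) with pairwise inner
products `≤ 0`. [folklore] -/
theorem card_le_two_mul (hn : 3 ≤ n) (C : Finset (EuclideanSpace ℝ (Fin n))) (h1 : ∀ x ∈ C, ‖x‖ = 1)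
    (h0 : ∀ x ∈ C, ∀ y ∈ C, x ≠ y → inner ℝ x y ≤ 0) : C.card ≤ 2 * n := by
  set μ : ℝ := ((n : ℝ) - 2) / 2 with hμdef
  have hn3 : (3 : ℝ) ≤ n := by exact_mod_cast hn
  have hμ : 0 < μ := by rw [hμdef]; linarith
  have hnμ : (n : ℝ) = 2 * μ + 2 := by rw [hμdef]; ring
  have h := DelsarteLP.card_le hnμ hμ 2 (fun k : ℕ => if k = 0 then μ else if k = 1 then μ + 1 else (1 : ℝ))
    (fun k => by split_ifs <;> linarith) 0
    (fun t ht hs => by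
      rw [cert_eval]; exact mul_nonpos_of_nonneg_of_nonpos (by positivity) (by nlinarith)) (2 * n)
    (by simp [hμ])
    (by rw [cert_eval]; simp; nlinarith) C h1 h0
  exact h

/-- **Complementary slackness at `2n` points**: every inner product of two distinct points is `0` or `-1`. -/
theorem inner_eq_zero_or_of_card_eq (hn : 3 ≤ n) (C : Finset (EuclideanSpace ℝ (Fin n)))
    (h1 : ∀ x ∈ C, ‖x‖ = 1) (h0 : ∀ x ∈ C, ∀ y ∈ C, x ≠ y → inner ℝ x y ≤ 0) (hcard : C.card = 2 * n)
    {x y : EuclideanSpace ℝ (Fin n)} (hx : x ∈ C) (hy : y ∈ C) (hxy : x ≠ y) :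
    inner ℝ x y = 0 ∨ inner ℝ x y = -1 := by
  set μ : ℝ := ((n : ℝ) - 2) / 2 with hμdef
  have hn3 : (3 : ℝ) ≤ n := by exact_mod_cast hn
  have hμ : 0 < μ := by rw [hμdef]; linarith
  have hnμ : (n : ℝ) = 2 * μ + 2 := by rw [hμdef]; ring
  have h := DelsarteLP.sum_eq_zero_of_card_mul_eq hnμ hμ 2
    (fun k : ℕ => if k = 0 then μ else if k = 1 then μ + 1 else (1 : ℝ))
    (fun k => by split_ifs <;> linarith) 0
    (fun t ht hs => by
      rw [cert_eval]; exact mul_nonpos_of_nonneg_of_nonpos (by positivity) (by nlinarith)) C h1 h0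
    (by rw [cert_eval, hcard]; simp; rw [hnμ]; ring) hx hy hxy
  rw [cert_eval] at h
  have hμ2 : 2 * μ * (μ + 1) ≠ 0 := by positivity
  have ht : inner ℝ x y * (1 + inner ℝ x y) = 0 := by
    rcases mul_eq_zero.mp h with h | h
    · exact absurd h hμ2
    · exact h
  rcases mul_eq_zero.mp ht with h | h
  · exact Or.inl h
  · exact Or.inr (by linarith)

/-- Unit vectors with inner product `-1` are antipodal. [folklore] -/
theorem eq_neg_of_inner_eq_neg_one {x y : EuclideanSpace ℝ (Fin n)} (hx : ‖x‖ = 1) (hy : ‖y‖ = 1)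
    (h : inner ℝ x y = -1) : y = -x := by
  have h0 : ‖x + y‖ ^ 2 = 0 := by
    rw [← real_inner_self_eq_norm_sq, inner_add_left, inner_add_right, inner_add_right,
      real_inner_self_eq_norm_sq, real_inner_self_eq_norm_sq, hx, hy, real_inner_comm x y, h]
    norm_num
  have : x + y = 0 := norm_eq_zero.mp (pow_eq_zero_iff two_ne_zero |>.mp h0)
  exact (neg_eq_of_add_eq_zero_right this).symm

/-- **Structure of a `2n`-point code at angle `π/2`: an orthonormal frame and its negatives.** There is
`R ⊆ C` with `|R| = n`, pairwise orthogonal, such that every point of `C` is in `R` or has its antipode in `R`,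
and `C = R ∪ (-R)`. -/
theorem exists_frame (hn : 3 ≤ n) (C : Finset (EuclideanSpace ℝ (Fin n))) (h1 : ∀ x ∈ C, ‖x‖ = 1)
    (h0 : ∀ x ∈ C, ∀ y ∈ C, x ≠ y → inner ℝ x y ≤ 0) (hcard : C.card = 2 * n) :
    ∃ R : Finset (EuclideanSpace ℝ (Fin n)), R ⊆ C ∧ R.card = n ∧
      (∀ x ∈ R, ∀ y ∈ R, x ≠ y → inner ℝ x y = 0) ∧
      C = R ∪ R.image (fun x => -x) := by
  classical
  -- a maximal antipodal-free subset
  let S := C.powerset.filter fun R => ∀ x ∈ R, -x ∉ R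
  have hSne : S.Nonempty := ⟨∅, by simp [S]⟩
  obtain ⟨R, hRS, hRmax⟩ := Finset.exists_max_image S Finset.card hSne
  simp only [S, mem_filter, mem_powerset] at hRS
  obtain ⟨hRC, hRfree⟩ := hRS
  -- pairwise orthogonal
  have horth : ∀ x ∈ R, ∀ y ∈ R, x ≠ y → inner ℝ x y = 0 := by
    intro x hx y hy hxy
    rcases inner_eq_zero_or_of_card_eq hn C h1 h0 hcard (hRC hx) (hRC hy) hxy with h | h
    · exact h
    · exact absurd (eq_neg_of_inner_eq_neg_one (h1 x (hRC hx)) (h1 y (hRC hy)) h ▸ hy) (hRfree x hx)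
  -- `|R| ≤ n`: an orthonormal family
  have hRle : R.card ≤ n := by
    have hon : Orthonormal ℝ (fun x : R => (x : EuclideanSpace ℝ (Fin n))) := by
      rw [orthonormal_iff_ite]
      intro x y
      by_cases hxy : x = y
      · subst hxy; rw [if_pos rfl, real_inner_self_eq_norm_sq, h1 _ (hRC x.2)]; norm_num
      · rw [if_neg hxy]
        exact horth _ x.2 _ y.2 fun h => hxy (Subtype.ext h)
    have h := hon.linearIndependent.fintype_card_le_finrank
    rw [finrank_euclideanSpace_fin, Fintype.card_coe] at h
    exact h
  -- covering: every point of `C` is in `R` or has its antipode in `R`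
  have hcover : ∀ x ∈ C, x ∈ R ∨ -x ∈ R := by
    intro x hx
    by_contra hnot
    push Not at hnot
    obtain ⟨hxR, hnxR⟩ := hnot
    have hx0 : x ≠ 0 := by
      intro h; have := h1 x hx; rw [h, norm_zero] at this; exact zero_ne_one this
    have hins : insert x R ∈ S := by
      simp only [S, mem_filter, mem_powerset]
      refine ⟨Finset.insert_subset hx hRC, fun y hy => ?_⟩
      rcases Finset.mem_insert.mp hy with rfl | hyR
      · rw [Finset.mem_insert, not_or]
        refine ⟨fun h => hx0 ?_, hnxR⟩
        have h2 : y + y = 0 := by nth_rewrite 1 [← h]; exact neg_add_cancel y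
        have h3 : (2 : ℝ) • y = 0 := by rwa [two_smul]
        exact (smul_eq_zero.mp h3).resolve_left two_ne_zero
      · rw [Finset.mem_insert, not_or]
        exact ⟨fun h => hnxR (by rw [← h, neg_neg]; exact hyR), hRfree y hyR⟩
    have := hRmax _ hins
    rw [Finset.card_insert_of_notMem hxR] at this
    omega
  -- counting
  have hsub : C ⊆ R ∪ R.image (fun x => -x) := by
    intro x hx
    rcases hcover x hx with h | h
    · exact Finset.mem_union_left _ h
    · refine Finset.mem_union_right _ (Finset.mem_image.mpr ⟨-x, h, neg_neg x⟩)
  have hUle : (R ∪ R.image (fun x => -x)).card ≤ R.card + R.card :=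
    (Finset.card_union_le _ _).trans (Nat.add_le_add_left Finset.card_image_le _)
  have hcardR : R.card = n := by
    have := Finset.card_le_card hsub; omega
  have hCeq : C = R ∪ R.image (fun x => -x) :=
    Finset.eq_of_subset_of_card_le hsub (by omega)
  exact ⟨R, hRC, hcardR, horth, hCeq⟩

/-- **Uniqueness of the cross-polytope codes** (Cohn–Kumar Table 1, cross-polytope rows): for `n ≥ 3`, any two
`2n`-point configurations of unit vectors of `ℝⁿ` with pairwise inner products `≤ 0` are isometric (each is an
orthonormal frame together with its negatives). [cite: CohnKumar2006, Table 1] -/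
theorem isometric_of_crossPolytope_codes (hn : 3 ≤ n) (C C' : Finset (EuclideanSpace ℝ (Fin n)))
    (h1 : ∀ x ∈ C, ‖x‖ = 1) (h0 : ∀ x ∈ C, ∀ y ∈ C, x ≠ y → inner ℝ x y ≤ 0) (hcard : C.card = 2 * n)
    (h1' : ∀ x ∈ C', ‖x‖ = 1) (h0' : ∀ x ∈ C', ∀ y ∈ C', x ≠ y → inner ℝ x y ≤ 0)
    (hcard' : C'.card = 2 * n) :
    ∃ Ψ : EuclideanSpace ℝ (Fin n) ≃ₗᵢ[ℝ] EuclideanSpace ℝ (Fin n), C' = C.image Ψ := by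
  classical
  obtain ⟨R, hRC, hR, horth, hC⟩ := exists_frame hn C h1 h0 hcard
  obtain ⟨R', hRC', hR', horth', hC'⟩ := exists_frame hn C' h1' h0' hcard'
  let e : Fin n ≃ R := (hR ▸ R.equivFin).symm
  let e' : Fin n ≃ R' := (hR' ▸ R'.equivFin).symm
  let v : Fin n ⊕ Fin n → EuclideanSpace ℝ (Fin n) :=
    fun s => Sum.elim (fun i => (e i : EuclideanSpace ℝ (Fin n))) (fun i => -(e i : EuclideanSpace ℝ (Fin n))) s
  let w : Fin n ⊕ Fin n → EuclideanSpace ℝ (Fin n) :=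
    fun s => Sum.elim (fun i => (e' i : EuclideanSpace ℝ (Fin n))) (fun i => -(e' i : EuclideanSpace ℝ (Fin n))) s
  -- Gram data of a frame
  have hG : ∀ i j : Fin n, inner ℝ (e i : EuclideanSpace ℝ (Fin n)) (e j) = if i = j then 1 else 0 := by
    intro i j
    by_cases hij : i = j
    · subst hij
      rw [if_pos rfl, real_inner_self_eq_norm_sq, h1 _ (hRC (e i).2)]; norm_num
    · rw [if_neg hij]
      exact horth _ (e i).2 _ (e j).2 fun h => hij (e.injective (Subtype.ext h))
  have hG' : ∀ i j : Fin n, inner ℝ (e' i : EuclideanSpace ℝ (Fin n)) (e' j) = if i = j then 1 else 0 := by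
    intro i j
    by_cases hij : i = j
    · subst hij
      rw [if_pos rfl, real_inner_self_eq_norm_sq, h1' _ (hRC' (e' i).2)]; norm_num
    · rw [if_neg hij]
      exact horth' _ (e' i).2 _ (e' j).2 fun h => hij (e'.injective (Subtype.ext h))
  have hgram : ∀ a b, inner ℝ (v a) (v b) = inner ℝ (w a) (w b) := by
    rintro (i | i) (j | j) <;>
      simp only [v, w, Sum.elim_inl, Sum.elim_inr, inner_neg_left, inner_neg_right, hG, hG']
  obtain ⟨Ψ, hΨ⟩ := exists_linearIsometryEquiv_of_inner_eq v w hgram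
  refine ⟨Ψ, ?_⟩
  -- `Ψ` maps `R` onto `R'` and `-R` onto `-R'`
  have hΨR : R.image Ψ = R' := by
    ext y
    simp only [Finset.mem_image]
    constructor
    · rintro ⟨x, hx, rfl⟩
      have := hΨ (Sum.inl (e.symm ⟨x, hx⟩))
      simp only [v, w, Sum.elim_inl, Equiv.apply_symm_apply] at this
      rw [this]; exact (e' _).2
    · intro hy
      refine ⟨(e (e'.symm ⟨y, hy⟩) : EuclideanSpace ℝ (Fin n)), (e _).2, ?_⟩
      have := hΨ (Sum.inl (e'.symm ⟨y, hy⟩))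
      simp only [v, w, Sum.elim_inl, Equiv.apply_symm_apply] at this
      exact this
  have hΨnR : (R.image (fun x => -x)).image Ψ = R'.image (fun x => -x) := by
    rw [Finset.image_image, ← hΨR, Finset.image_image]
    refine Finset.image_congr fun x hx => ?_
    simp only [Function.comp_apply, map_neg]
  rw [hC', hC, Finset.image_union, hΨR, hΨnR]

end Summit.Ventures.PackingBounds.Config.CrossPolytopeUnique

end
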